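import Literature.MathematicalPhysics.QuantumLattice.HubbardOneParticleCost
import Literature.MathematicalPhysics.QuantumLattice.HubbardModelParticleHoleProofs
import HarnessLib

/-!
# The spin sectors `(N↑, N↓) = (a, b)` of the Hubbard model: bookkeeping

Trunk T-QLATTICE (family `hubbard`); companion of `HubbardLiebConfig.lean` (`IsInSector a b`),
`HubbardModel.lean` (`szSector N M`) and `HubbardRingPerronFrobeniusProofs.lean` (which treats the
sector `(n, n)` only). Written for the support item `ParityGapClustering` of the route
`HubbardSuperconductivity/ParityGapRigidity`, whose proof moves between the sector `(n, n)` of a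
ground state `ψ` and the four neighbouring sectors reached by `c_{yσ} ψ` and `c†_{xσ} ψ`.
All statements are elementary (Lieb, PRL 62 (1989) 1201, proof of Thm. 1 — "work in a sector";
Tasaki (2020) §2.2, §9.3) and proved here:

* `mem_szSector_iff_isInSector` — `szSector (a + b) ((a - b)/2)` IS the coordinate sector
  `IsInSector a b`;
* `IsInSector.creation_up_mulVec`, `…_down_…`, `IsInSector.annihilation_up_mulVec`, `…_down_…` —
  `c†_{x↑} : (a, b) → (a + 1, b)`, `c_{x↑} : (a + 1, b) → (a, b)`, and the down analogues;
* `dotProduct_eq_zero_of_isInSector` — distinct sectors are orthogonal;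
* `exists_creation_up_mulVec_ne_zero` (`a < |Λ|`), `exists_annihilation_up_mulVec_ne_zero`
  (`1 ≤ a`) and the down analogues — room to add / remove an electron;
* `hamiltonian_apply_eq_zero_of_sector_ne` — `H` has no matrix entries between different sectors;
* `mul_norm_le_of_unit_bound_submodule`, `upDownSector_groundState` — in every sector `(a, b)` with
  `a, b ≤ |Λ|` the sector energy `minEnergyOn H (szSector (a+b) ((a-b)/2))` is attained at an
  eigenvector of `H` in the sector and bounds `Re ⟨φ, Hφ⟩ ≥ E ⟨φ, φ⟩` on the sector.
-/

noncomputable section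

namespace Literature.MathematicalPhysics.QuantumLattice

open Matrix Finset HubbardWave0
open scoped ComplexOrder

variable {Λ : Type*} [LinearOrder Λ] [Fintype Λ]

/-! ### `szSector` versus `IsInSector` -/

/-- **The joint sector `(N, S^z) = (a + b, (a - b)/2)` is the coordinate sector `(N↑, N↓) = (a, b)`.**
Lieb, PRL 62 (1989) 1201, eq. (2) and proof of Theorem 1. [folklore] -/
theorem mem_szSector_iff_isInSector (a b : ℕ) (ψ : Fock (Orb Λ)) :
    ψ ∈ szSector (a + b) (((a : ℝ) - b) / 2) ↔ IsInSector a b ψ := by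
  rw [mem_szSector_iff]
  constructor
  · rintro ⟨hN, hZ⟩ s hs
    by_cases hcard : s.card = a + b
    · by_contra hψ
      have h := congrFun hZ s
      rw [LiebThm1.spinZ_mulVec_apply, Pi.smul_apply, smul_eq_mul] at h
      have h2 : (1 / 2 : ℂ) * (((upPart s).card : ℂ) - ((downPart s).card : ℂ)) =
          ((((a : ℝ) - b) / 2 : ℝ) : ℂ) := mul_right_cancel₀ hψ h
      push_cast at h2
      have hsum : (upPart s).card + (downPart s).card = a + b := by
        rw [← card_eq_upPart_add_downPart, hcard]
      have h3 : ((upPart s).card : ℂ) - (downPart s).card = (a : ℂ) - b := by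
        linear_combination 2 * h2
      have h4 : (((upPart s).card : ℤ) : ℂ) - (((downPart s).card : ℤ) : ℂ) =
          ((a : ℤ) : ℂ) - ((b : ℤ) : ℂ) := by exact_mod_cast h3
      rw [← Int.cast_sub, ← Int.cast_sub] at h4
      have h5 : ((upPart s).card : ℤ) - (downPart s).card = (a : ℤ) - b := Int.cast_injective h4
      exact hs ⟨by omega, by omega⟩
    · exact hN s hcard
  · intro h
    refine ⟨h.isNParticle, ?_⟩
    rw [LiebThm1.spinZ_mulVec_of_isInSector h]
    congr 1
    push_cast
    ring

/-- The `S^z = 0` sector with `2n` electrons is the sector `(n, n)` (restated through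
`mem_szSector_iff_isInSector`). Lieb, PRL 62 (1989) 1201. [folklore] -/
theorem szSector_two_mul_zero_eq (n : ℕ) :
    (szSector (2 * n) 0 : Submodule ℂ (Fock (Orb Λ))) = szSector (n + n) (((n : ℝ) - n) / 2) := by
  rw [two_mul, sub_self, zero_div]

/-! ### Creation and annihilation operators between neighbouring sectors -/

/-- `c†_{x↑}` maps the sector `(a, b)` to `(a + 1, b)`. Lieb, PRL 62 (1989) 1201, eq. (2). [folklore] -/
theorem IsInSector.creation_up_mulVec {a b : ℕ} {ψ : Fock (Orb Λ)} (hψ : IsInSector a b ψ) (x : Λ) :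
    IsInSector (a + 1) b (creation (orb x 0) *ᵥ ψ) := by
  intro s hs
  rw [creation_mulVec_apply]
  split_ifs with hx
  · obtain ⟨α, β, rfl⟩ : ∃ α β, s = pairSet α β :=
      ⟨upPart s, downPart s, (pairSet_upPart_downPart s).symm⟩
    rw [orb_zero_mem_pairSet] at hx
    rw [upPart_pairSet, downPart_pairSet] at hs
    rw [pairSet_erase_zero, hψ _ ?_, mul_zero]
    rw [upPart_pairSet, downPart_pairSet, card_erase_of_mem hx]
    have ha := card_pos.2 ⟨x, hx⟩
    omega
  · rfl

/-- `c†_{x↓}` maps the sector `(a, b)` to `(a, b + 1)`. Lieb, PRL 62 (1989) 1201, eq. (2). [folklore] -/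
theorem IsInSector.creation_down_mulVec {a b : ℕ} {ψ : Fock (Orb Λ)} (hψ : IsInSector a b ψ) (x : Λ) :
    IsInSector a (b + 1) (creation (orb x 1) *ᵥ ψ) := by
  intro s hs
  rw [creation_mulVec_apply]
  split_ifs with hx
  · obtain ⟨α, β, rfl⟩ : ∃ α β, s = pairSet α β :=
      ⟨upPart s, downPart s, (pairSet_upPart_downPart s).symm⟩
    rw [orb_one_mem_pairSet] at hx
    rw [upPart_pairSet, downPart_pairSet] at hs
    rw [pairSet_erase_one, hψ _ ?_, mul_zero]
    rw [upPart_pairSet, downPart_pairSet, card_erase_of_mem hx]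
    have hb := card_pos.2 ⟨x, hx⟩
    omega
  · rfl

/-- `c_{x↑}` maps the sector `(a + 1, b)` to `(a, b)`. Lieb, PRL 62 (1989) 1201, eq. (2). [folklore] -/
theorem IsInSector.annihilation_up_mulVec {a b : ℕ} {ψ : Fock (Orb Λ)} (hψ : IsInSector (a + 1) b ψ)
    (x : Λ) : IsInSector a b (annihilation (orb x 0) *ᵥ ψ) := by
  intro s hs
  rw [annihilation_mulVec_apply]
  split_ifs with hx
  · rfl
  · obtain ⟨α, β, rfl⟩ : ∃ α β, s = pairSet α β :=
      ⟨upPart s, downPart s, (pairSet_upPart_downPart s).symm⟩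
    rw [orb_zero_mem_pairSet] at hx
    rw [upPart_pairSet, downPart_pairSet] at hs
    rw [pairSet_insert_zero, hψ _ ?_, mul_zero]
    rw [upPart_pairSet, downPart_pairSet, card_insert_of_notMem hx]
    omega

/-- `c_{x↓}` maps the sector `(a, b + 1)` to `(a, b)`. Lieb, PRL 62 (1989) 1201, eq. (2). [folklore] -/
theorem IsInSector.annihilation_down_mulVec {a b : ℕ} {ψ : Fock (Orb Λ)}
    (hψ : IsInSector a (b + 1) ψ) (x : Λ) : IsInSector a b (annihilation (orb x 1) *ᵥ ψ) := by
  intro s hs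
  rw [annihilation_mulVec_apply]
  split_ifs with hx
  · rfl
  · obtain ⟨α, β, rfl⟩ : ∃ α β, s = pairSet α β :=
      ⟨upPart s, downPart s, (pairSet_upPart_downPart s).symm⟩
    rw [orb_one_mem_pairSet] at hx
    rw [upPart_pairSet, downPart_pairSet] at hs
    rw [pairSet_insert_one, hψ _ ?_, mul_zero]
    rw [upPart_pairSet, downPart_pairSet, card_insert_of_notMem hx]
    omega

/-- In the `0`-up-electron sectors `c_{x↑}` vanishes. [folklore] -/
theorem IsInSector.annihilation_up_mulVec_eq_zero {b : ℕ} {ψ : Fock (Orb Λ)} (hψ : IsInSector 0 b ψ)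
    (x : Λ) : annihilation (orb x 0) *ᵥ ψ = 0 := by
  funext s
  rw [annihilation_mulVec_apply, Pi.zero_apply]
  split_ifs with hx
  · rfl
  · rw [hψ _ ?_, mul_zero]
    intro h
    have : x ∈ upPart (insert (orb x 0) s) := by rw [mem_upPart]; exact mem_insert_self _ _
    rw [card_eq_zero.1 h.1] at this
    exact notMem_empty _ this

/-- In the `0`-down-electron sectors `c_{x↓}` vanishes. [folklore] -/
theorem IsInSector.annihilation_down_mulVec_eq_zero {a : ℕ} {ψ : Fock (Orb Λ)} (hψ : IsInSector a 0 ψ)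
    (x : Λ) : annihilation (orb x 1) *ᵥ ψ = 0 := by
  funext s
  rw [annihilation_mulVec_apply, Pi.zero_apply]
  split_ifs with hx
  · rfl
  · rw [hψ _ ?_, mul_zero]
    intro h
    have : x ∈ downPart (insert (orb x 1) s) := by rw [mem_downPart]; exact mem_insert_self _ _
    rw [card_eq_zero.1 h.2] at this
    exact notMem_empty _ this

/-- **Distinct sectors are orthogonal.** [folklore] -/
theorem dotProduct_eq_zero_of_isInSector {a b a' b' : ℕ} (h : ¬(a = a' ∧ b = b')) {u v : Fock (Orb Λ)}
    (hu : IsInSector a b u) (hv : IsInSector a' b' v) : star u ⬝ᵥ v = 0 := by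
  rw [dotProduct]
  refine Finset.sum_eq_zero fun s _ => ?_
  by_cases hs : (upPart s).card = a ∧ (downPart s).card = b
  · rw [hv s (fun hs' => h ⟨hs.1.symm.trans hs'.1, hs.2.symm.trans hs'.2⟩), mul_zero]
  · rw [Pi.star_apply, hu s hs, star_zero, zero_mul]

/-- A nonzero vector of the sector `(a, b)` forces `a, b ≤ |Λ|`. [folklore] -/
theorem le_card_of_isInSector {a b : ℕ} {ψ : Fock (Orb Λ)} (hψ : IsInSector a b ψ) (h0 : ψ ≠ 0) :
    a ≤ Fintype.card Λ ∧ b ≤ Fintype.card Λ := by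
  obtain ⟨s, hs⟩ : ∃ s, ψ s ≠ 0 := Function.ne_iff.mp h0
  have hsec : (upPart s).card = a ∧ (downPart s).card = b := by
    by_contra h; exact hs (hψ s h)
  exact ⟨hsec.1 ▸ Finset.card_le_univ _, hsec.2 ▸ Finset.card_le_univ _⟩

/-! ### Room to add or remove an electron -/

/-- If `a < |Λ|`, some `c†_{z↑}` does not kill a nonzero vector of the sector `(a, b)`. [folklore] -/
theorem exists_creation_up_mulVec_ne_zero {a b : ℕ} {χ : Fock (Orb Λ)} (hχ : IsInSector a b χ)
    (hχ0 : χ ≠ 0) (ha : a < Fintype.card Λ) : ∃ z : Λ, creation (orb z 0) *ᵥ χ ≠ 0 := by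
  by_contra hall
  push Not at hall
  obtain ⟨s, hs⟩ : ∃ s, χ s ≠ 0 := Function.ne_iff.mp hχ0
  have hsec : (upPart s).card = a ∧ (downPart s).card = b := by
    by_contra h; exact hs (hχ s h)
  have hlt : (upPart s).card < (Finset.univ : Finset Λ).card := by rw [card_univ, hsec.1]; exact ha
  obtain ⟨z, -, hz⟩ := exists_mem_notMem_of_card_lt_card hlt
  rw [mem_upPart] at hz
  have h := congrFun (hall z) (insert (orb z 0) s)
  rw [creation_mulVec_apply, if_pos (mem_insert_self _ _), erase_insert hz, Pi.zero_apply] at h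
  exact hs ((mul_eq_zero.1 h).resolve_left (jwSign_ne_zero _ _))

/-- If `b < |Λ|`, some `c†_{z↓}` does not kill a nonzero vector of the sector `(a, b)`. [folklore] -/
theorem exists_creation_down_mulVec_ne_zero {a b : ℕ} {χ : Fock (Orb Λ)} (hχ : IsInSector a b χ)
    (hχ0 : χ ≠ 0) (hb : b < Fintype.card Λ) : ∃ z : Λ, creation (orb z 1) *ᵥ χ ≠ 0 := by
  by_contra hall
  push Not at hall
  obtain ⟨s, hs⟩ : ∃ s, χ s ≠ 0 := Function.ne_iff.mp hχ0
  have hsec : (upPart s).card = a ∧ (downPart s).card = b := by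
    by_contra h; exact hs (hχ s h)
  have hlt : (downPart s).card < (Finset.univ : Finset Λ).card := by rw [card_univ, hsec.2]; exact hb
  obtain ⟨z, -, hz⟩ := exists_mem_notMem_of_card_lt_card hlt
  rw [mem_downPart] at hz
  have h := congrFun (hall z) (insert (orb z 1) s)
  rw [creation_mulVec_apply, if_pos (mem_insert_self _ _), erase_insert hz, Pi.zero_apply] at h
  exact hs ((mul_eq_zero.1 h).resolve_left (jwSign_ne_zero _ _))

/-- If `1 ≤ a`, some `c_{z↑}` does not kill a nonzero vector of the sector `(a, b)`. [folklore] -/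
theorem exists_annihilation_up_mulVec_ne_zero {a b : ℕ} {χ : Fock (Orb Λ)} (hχ : IsInSector a b χ)
    (hχ0 : χ ≠ 0) (ha : 1 ≤ a) : ∃ z : Λ, annihilation (orb z 0) *ᵥ χ ≠ 0 := by
  by_contra hall
  push Not at hall
  obtain ⟨s, hs⟩ : ∃ s, χ s ≠ 0 := Function.ne_iff.mp hχ0
  have hsec : (upPart s).card = a ∧ (downPart s).card = b := by
    by_contra h; exact hs (hχ s h)
  obtain ⟨z, hz⟩ : (upPart s).Nonempty := card_pos.1 (by omega)
  rw [mem_upPart] at hz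
  have h := congrFun (hall z) (s.erase (orb z 0))
  rw [annihilation_mulVec_apply, if_pos (notMem_erase _ _), insert_erase hz, Pi.zero_apply] at h
  exact hs ((mul_eq_zero.1 h).resolve_left (jwSign_ne_zero _ _))

/-- If `1 ≤ b`, some `c_{z↓}` does not kill a nonzero vector of the sector `(a, b)`. [folklore] -/
theorem exists_annihilation_down_mulVec_ne_zero {a b : ℕ} {χ : Fock (Orb Λ)} (hχ : IsInSector a b χ)
    (hχ0 : χ ≠ 0) (hb : 1 ≤ b) : ∃ z : Λ, annihilation (orb z 1) *ᵥ χ ≠ 0 := by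
  by_contra hall
  push Not at hall
  obtain ⟨s, hs⟩ : ∃ s, χ s ≠ 0 := Function.ne_iff.mp hχ0
  have hsec : (upPart s).card = a ∧ (downPart s).card = b := by
    by_contra h; exact hs (hχ s h)
  obtain ⟨z, hz⟩ : (downPart s).Nonempty := card_pos.1 (by omega)
  rw [mem_downPart] at hz
  have h := congrFun (hall z) (s.erase (orb z 1))
  rw [annihilation_mulVec_apply, if_pos (notMem_erase _ _), insert_erase hz, Pi.zero_apply] at h
  exact hs ((mul_eq_zero.1 h).resolve_left (jwSign_ne_zero _ _))

/-! ### Sector ground states -/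

section Hamiltonian

variable (G : SimpleGraph Λ) [DecidableRel G.Adj]

/-- `H` has no matrix entries between different sectors `(a, b)`. Lieb, PRL 62 (1989) 1201,
Remark (2)(i). [folklore] -/
theorem hamiltonian_apply_eq_zero_of_sector_ne (t U : ℝ) (a b : ℕ) (s s' : Finset (Orb Λ))
    (hs : ¬((upPart s).card = a ∧ (downPart s).card = b))
    (hs' : (upPart s').card = a ∧ (downPart s').card = b) : hamiltonian G t U s s' = 0 := by
  by_contra h
  have := LiebThm1.preservesSectors_hamiltonian G t U s s' h
  exact hs ⟨this.1.trans hs'.1, this.2.trans hs'.2⟩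

omit [LinearOrder Λ] [DecidableRel G.Adj] in
/-- From the bound on unit vectors of a subspace to the homogeneous bound `E ⟨φ, φ⟩ ≤ Re ⟨φ, Hφ⟩`
on it (normalise `φ ≠ 0`). Tasaki (2020) §2.1. [folklore] -/
theorem mul_norm_le_of_unit_bound_submodule (H : Matrix (Finset (Orb Λ)) (Finset (Orb Λ)) ℂ)
    (K : Submodule ℂ (Fock (Orb Λ))) {E : ℝ}
    (hb : ∀ v ∈ K, star v ⬝ᵥ v = 1 → E ≤ (star v ⬝ᵥ H *ᵥ v).re)
    {φ : Fock (Orb Λ)} (hφ : φ ∈ K) : E * (star φ ⬝ᵥ φ).re ≤ (expect H φ).re := by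
  by_cases h0 : φ = 0
  · subst h0
    simp [expect]
  obtain ⟨c, hc0, hc1⟩ := exists_smul_unit h0
  have h2 := hb _ (K.smul_mem c hφ) hc1
  have hcc : star c * c = ((‖c‖ ^ 2 : ℝ) : ℂ) := by
    rw [Complex.star_def, Complex.conj_mul']
    push_cast
    rfl
  rw [mulVec_smul, star_smul, smul_dotProduct, dotProduct_smul, smul_smul, hcc, smul_eq_mul,
    Complex.re_ofReal_mul] at h2
  rw [star_smul, smul_dotProduct, dotProduct_smul, smul_smul, hcc, smul_eq_mul] at hc1
  have h1 : ‖c‖ ^ 2 * (star φ ⬝ᵥ φ).re = 1 := by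
    have := congrArg Complex.re hc1
    rwa [Complex.re_ofReal_mul, Complex.one_re] at this
  have hpos : 0 < ‖c‖ ^ 2 := by positivity
  have key : ‖c‖ ^ 2 * (E * (star φ ⬝ᵥ φ).re) ≤ ‖c‖ ^ 2 * (expect H φ).re :=
    calc ‖c‖ ^ 2 * (E * (star φ ⬝ᵥ φ).re) = E * (‖c‖ ^ 2 * (star φ ⬝ᵥ φ).re) := by ring
      _ = E := by rw [h1, mul_one]
      _ ≤ ‖c‖ ^ 2 * (expect H φ).re := h2
  exact le_of_mul_le_mul_left key hpos

/-- **Ground states exist in every sector `(a, b)` with `a, b ≤ |Λ|`**, and the sector energy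
`minEnergyOn H (szSector (a+b) ((a-b)/2))` bounds `H` from below on the sector: `H` is Hermitian
and block diagonal in `(N↑, N↓)`, so `sector_groundState` applies. Tasaki (2020) §2.2; Lieb, PRL 62
(1989) 1201, proof of Theorem 1. [folklore] -/
theorem upDownSector_groundState (t U : ℝ) {a b : ℕ} (ha : a ≤ Fintype.card Λ)
    (hb : b ≤ Fintype.card Λ) :
    (∃ χ, IsInSector a b χ ∧ χ ≠ 0 ∧ hamiltonian G t U *ᵥ χ =
        (((hamiltonian G t U).minEnergyOn (szSector (a + b) (((a : ℝ) - b) / 2)) : ℝ) : ℂ) • χ) ∧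
      ∀ φ : Fock (Orb Λ), IsInSector a b φ →
        (hamiltonian G t U).minEnergyOn (szSector (a + b) (((a : ℝ) - b) / 2)) * (star φ ⬝ᵥ φ).re ≤
          (expect (hamiltonian G t U) φ).re := by
  classical
  obtain ⟨α₀, -, hα₀⟩ : ∃ α₀ : Finset Λ, α₀ ⊆ univ ∧ α₀.card = a :=
    Finset.exists_subset_card_eq (by rwa [Finset.card_univ])
  obtain ⟨β₀, -, hβ₀⟩ : ∃ β₀ : Finset Λ, β₀ ⊆ univ ∧ β₀.card = b :=
    Finset.exists_subset_card_eq (by rwa [Finset.card_univ])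
  have hp : ∃ s : Finset (Orb Λ), (upPart s).card = a ∧ (downPart s).card = b :=
    ⟨pairSet α₀ β₀, by rw [upPart_pairSet, hα₀], by rw [downPart_pairSet, hβ₀]⟩
  have hK : ∀ v : Fock (Orb Λ), v ∈ szSector (a + b) (((a : ℝ) - b) / 2) ↔
      ∀ s, ¬((upPart s).card = a ∧ (downPart s).card = b) → v s = 0 :=
    fun v => mem_szSector_iff_isInSector a b v
  obtain ⟨⟨v, hv, hv0, hHv⟩, hbd⟩ := sector_groundState (hamiltonian G t U)
    (LiebThm1.hamiltonian_isHermitian G t U) (fun s => (upPart s).card = a ∧ (downPart s).card = b)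
    hp (fun s s' hs hs' => hamiltonian_apply_eq_zero_of_sector_ne G t U a b s s' hs hs')
    (szSector (a + b) (((a : ℝ) - b) / 2)) hK
  refine ⟨⟨v, (hK v).1 hv, hv0, hHv⟩, fun φ hφ => ?_⟩
  exact mul_norm_le_of_unit_bound_submodule (hamiltonian G t U) _ hbd ((hK φ).2 hφ)

end Hamiltonian

end Literature.MathematicalPhysics.QuantumLattice
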